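import Literature.NumberTheory.Automorphic.SymplecticGroupCartanUnique
import Mathlib.GroupTheory.Index
import Mathlib.GroupTheory.GroupAction.Quotient
import Mathlib.Algebra.Group.Subgroup.Pointwise
import Mathlib.RingTheory.Ideal.Norm.AbsNorm
import HarnessLib

/-!
# Indices of subgroups by dévissage (`[UH : H] = [U : U ∩ H]`, a two-step unipotent filtration) and the index
# `[ϖ^b 𝒪 : ϖ^a 𝒪] = q^{a-b}` of the valuation ideals of a `ℤᵐ⁰`-valued field (Cartier §I.3; Laumon (4.1.3)–(4.1.4);
# Serre, Corps locaux I §1, II §3)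

Topic `NumberTheory/Automorphic`; namespace `Literature.NumberTheory.Automorphic` (lane `lit-hodgefound`, Track 2
foundations; seat `lit-hodgefound-p11`, generation 45, row g45-#1).  THEOREMS ONLY: no definition, no named fact, no
instance, no notation.  The engine behind the EVALUATION of the modulus indices
`[K_P : K_P ∩ tK_Pt⁻¹]`, `[tK_Pt⁻¹ : K_P ∩ tK_Pt⁻¹]` (`K_P = B(𝒪)`) left abstract by `SatakeTransformDuality`
(g44-#1) and its instances for `Sp_{2n}`, `GSp_{2n}`, `U(σ, J₀)` (g44-#4, #6, #3) and by the rank-one Satake isomorphisms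
(g44-#8, #9): the torus is removed and the unipotent radical is filtered by subgroups with abelian quotients
«coordinatised» by valuation ideals of `K`, whose indices are powers of `q = #𝓀`.

## The mathematics

(§1) For subgroups `U ≤ L` and `H` of a group `G` with `L ⊆ U·H` the map `u(U ∩ H) ↦ uH` is a bijection
`U/(U ∩ H) ⥲ L/(L ∩ H)` (orbit–stabiliser for `U` acting on `L/(L ∩ H)`), so `[L : L ∩ H] = [U : U ∩ H]`
(`relIndex_eq_relIndex_of_coe_subset_mul`; Cartier §I.3: for `K_P = T(𝒪)·U(𝒪)` and `tK_Pt⁻¹ ⊇ T(𝒪)` this removes the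
torus: `[K_P : K_P ∩ tK_Pt⁻¹] = [U(𝒪) : U(𝒪) ∩ tU(𝒪)t⁻¹]`).  (§2) DÉVISSAGE: if `A ≤ A'` decompose compatibly as
`A = Q·N`, `A' = Q'·N'` with `N' ⊴ A'` (i.e. `A'` normalises `N'`), `Q ≤ Q'`, `A ∩ N' = N`, `Q' ∩ N' = 1`, then
`[A' : A] = [Q' : Q]·[N' : N]` (`relIndex_eq_mul_relIndex_of_devissage`) — the unipotent radical `U = U_M ⋉ N_P` of a
Borel inside a parabolic `P = MN_P`, filtered by the unipotent radical `N_P` (abelian for the Siegel parabolic of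
`Sp_{2n}`, a vector group column by column for `GL_n`), Laumon (4.1.3)–(4.1.4): `δ_B = ∏_{α>0} |α|` is computed root group
by root group.  (§3) THE COUNT: for a `ℤᵐ⁰`-valued field `K` with uniformiser `ϖ` and finite residue field `𝓀`,
`#𝓀 = q`, the balls `{v ≤ exp b} = ϖ^{-b}𝒪` satisfy **`[{v ≤ exp a} : {v ≤ exp b}] = q^{a-b}`** for `b ≤ a` (and `= 1`
for `a ≤ b`; `relIndex_leAddSubgroup_exp`): `𝒪` is a discrete valuation ring (tree: `isDiscreteValuationRing_integer`),
`{v ≤ exp(-k)} ∩ 𝒪 = (ϖ^k) = 𝔪^k` and `#(𝒪/𝔪^k) = #(𝒪/𝔪)^k` (Serre II §3: `𝔪^i/𝔪^{i+1} ≃ 𝓀`; Mathlib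
`cardQuot_pow_of_prime`), transported along `x ↦ ϖ^{-a}x`.  Multiplicative copies (`AddSubgroup.toSubgroup`) are
provided for transport along one-parameter subgroups `Multiplicative K →* G`.

## What is formalised (theorems only)

* §1 `stabilizer_coe_one_eq_subgroupOf`, **`relIndex_eq_index_of_forall_exists_mul`** (`G = U·H ⇒ [G : H] = [U : U ∩ H]`),
  **`relIndex_eq_relIndex_of_coe_subset_mul`** (`U ≤ L ⊆ U·H ⇒ [L : L ∩ H] = [U : U ∩ H]`).
* §2 (private `subset_mul_of_le_normalizer`: `A·N' ⊆ N'·A`), `sup_inf_eq_of_coe_subset_mul` (`(A ⊔ N') ∩ Q' = Q`),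
  **`relIndex_eq_mul_relIndex_of_devissage`** (`[A' : A] = [Q' : Q]·[N' : N]`).
* §3 (`Valued K ℤᵐ⁰`, `v ϖ = exp (-1)`, `[Finite 𝓀[K]]`) `leAddSubgroup_one_eq_toAddSubgroup_integer`,
  `map_mulLeft_leAddSubgroup` (`c·{v ≤ γ} = {v ≤ v(c)γ}`), `comap_subtype_leAddSubgroup_exp_neg` (`{v ≤ exp(-k)} ∩ 𝒪 = (ϖ^k)`),
  (private `range_toAddMonoidHom_subtype_integer`), `cardQuot_span_uniformizer_pow` (`#(𝒪/(ϖ^k)) = q^k`),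
  **`relIndex_leAddSubgroup_exp_neg_natCast`** (`[𝒪 : ϖ^k𝒪] = q^k`), **`relIndex_leAddSubgroup_exp`**
  (`[{v ≤ exp a} : {v ≤ exp b}] = q^{(a-b)⁺}` for all `a b ∈ ℤ`), `relIndex_toSubgroup_leAddSubgroup_exp` (multiplicative
  copy), `relIndex_leAddSubgroup_exp_ne_zero`.

## References
* [CartierCorvallis1979] P. Cartier, *Representations of 𝔭-adic groups: a survey*, PSPM 33.1 (1979), §I.3 (indices of
  commensurable compact open subgroups and Haar measure), §IV (4.2).
* [Laumon1995] G. Laumon, *Cohomology of Drinfeld Modular Varieties I*, CUP (1996), (4.1.3)–(4.1.4) (the modulus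
  `δ_B(b) = ∏_{i<j} |b_{ii}/b_{jj}|` as a product over root groups).
* [Serre1979] J.-P. Serre, *Local Fields*, GTM 67 (1979), Ch. I §1 Prop. 1; Ch. II §3 (the filtration `𝔪^n`,
  `𝔪^n/𝔪^{n+1}` one-dimensional over `𝓀`).
* [Macdonald1995] I. G. Macdonald, *Symmetric Functions and Hall Polynomials*, 2nd ed. (1995), Ch. II §1, Ch. V (2.6)–(2.7).
-/

open scoped Valued WithZero Pointwise
open MulAction

namespace Literature.NumberTheory.Automorphic

/-! ## §1 `[L : L ∩ H] = [U : U ∩ H]` when `L = U·H` -/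

section Products

variable {G : Type*} [Group G]

/-- The stabiliser in `U ≤ G` of the base point of `G/H` is `U ∩ H`. [cite: CartierCorvallis1979, §I.3] -/
theorem stabilizer_coe_one_eq_subgroupOf (U H : Subgroup G) :
    stabilizer U ((1 : G) : G ⧸ H) = H.subgroupOf U := by
  ext x
  rw [mem_stabilizer_iff, Subgroup.mem_subgroupOf]
  change (x : G) • ((1 : G) : G ⧸ H) = ((1 : G) : G ⧸ H) ↔ (x : G) ∈ H
  rw [Quotient.smul_coe, smul_eq_mul, mul_one, QuotientGroup.eq, mul_one, inv_mem_iff]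

/-- **`G = U·H ⇒ [G : H] = [U : U ∩ H]`** (every coset `gH` is `uH` with `u ∈ U`, unique up to `U ∩ H`: orbit–stabiliser
for `U` acting on `G/H`). [cite: CartierCorvallis1979, §I.3] -/
theorem relIndex_eq_index_of_forall_exists_mul {U H : Subgroup G} (h : ∀ g : G, ∃ u ∈ U, ∃ k ∈ H, g = u * k) :
    H.relIndex U = H.index := by
  have horb : orbit U ((1 : G) : G ⧸ H) = Set.univ := by
    refine Set.eq_univ_of_forall fun x => ?_
    induction x using QuotientGroup.induction_on with
    | H g =>
      obtain ⟨u, hu, k, hk, rfl⟩ := h g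
      refine mem_orbit_iff.2 ⟨⟨u, hu⟩, ?_⟩
      change (u : G) • ((1 : G) : G ⧸ H) = ((u * k : G) : G ⧸ H)
      rw [Quotient.smul_coe, smul_eq_mul, mul_one, QuotientGroup.eq, inv_mul_cancel_left]
      exact hk
  rw [Subgroup.relIndex, ← stabilizer_coe_one_eq_subgroupOf, index_stabilizer, horb, Set.ncard_univ,
    Subgroup.index_eq_card]

/-- **`U ≤ L ⊆ U·H ⇒ [L : L ∩ H] = [U : U ∩ H]`** (relative form; e.g. `L = K_P = T(𝒪)U(𝒪)`, `H = tK_Pt⁻¹ ⊇ T(𝒪)`,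
`U = U(𝒪)`: the torus drops out of the modulus index). [cite: CartierCorvallis1979, §I.3] [cite: Laumon1995, (4.1.4)] -/
theorem relIndex_eq_relIndex_of_coe_subset_mul {U H L : Subgroup G} (hUL : U ≤ L)
    (h : (L : Set G) ⊆ (U : Set G) * (H : Set G)) : H.relIndex L = H.relIndex U := by
  rw [← Subgroup.relIndex_subgroupOf hUL]
  symm
  refine relIndex_eq_index_of_forall_exists_mul (G := L) fun g => ?_
  obtain ⟨u, hu, k, hk, hg⟩ := Set.mem_mul.1 (h g.2)
  have hkL : k ∈ L := by
    have : k = u⁻¹ * (g : G) := by rw [← hg, inv_mul_cancel_left]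
    rw [this]
    exact L.mul_mem (L.inv_mem (hUL hu)) g.2
  refine ⟨⟨u, hUL hu⟩, Subgroup.mem_subgroupOf.2 hu, ⟨k, hkL⟩, Subgroup.mem_subgroupOf.2 hk, Subtype.ext ?_⟩
  exact hg.symm

end Products

/-! ## §2 Two-step dévissage `[A' : A] = [Q' : Q]·[N' : N]` -/

section Devissage

variable {G : Type*} [Group G]

/-- If `A` normalises `N'` then `A·N' ⊆ N'·A` (`a n = (a n a⁻¹) a`). [folklore] -/
private theorem subset_mul_of_le_normalizer {A N' : Subgroup G} (hAn : A ≤ Subgroup.normalizer (N' : Set G)) :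
    (A : Set G) * (N' : Set G) ⊆ (N' : Set G) * (A : Set G) := by
  rintro _ ⟨a, ha, n, hn, rfl⟩
  refine Set.mem_mul.2 ⟨a * n * a⁻¹, ?_, a, ha, by rw [inv_mul_cancel_right]⟩
  exact (Subgroup.mem_normalizer_iff.1 (hAn ha) n).1 hn

/-- **`(A ⊔ N') ∩ Q' = Q`** for `A = Q·N` with `Q ≤ Q'`, `N ≤ N'`, `A` normalising `N'` and `Q' ∩ N' = 1`: an element
`q n n'` of `A N'` lying in `Q'` has `n n' ∈ Q' ∩ N' = 1`. [cite: Laumon1995, (4.1.3)] -/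
theorem sup_inf_eq_of_coe_subset_mul {A N N' Q Q' : Subgroup G} (hA : (A : Set G) ⊆ (Q : Set G) * (N : Set G))
    (hQA : Q ≤ A) (hNN' : N ≤ N') (hQQ' : Q ≤ Q') (hAn : A ≤ Subgroup.normalizer (N' : Set G)) (hdisj : Q' ⊓ N' = ⊥) :
    (A ⊔ N') ⊓ Q' = Q := by
  refine le_antisymm (fun x hx => ?_) (le_inf (hQA.trans le_sup_left) hQQ')
  obtain ⟨hx, hxQ'⟩ := Subgroup.mem_inf.1 hx
  have hx' : x ∈ ((A ⊔ N' : Subgroup G) : Set G) := hx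
  rw [Subgroup.coe_mul_of_left_le_normalizer_right A N' hAn] at hx'
  obtain ⟨a, ha, n', hn', rfl⟩ := Set.mem_mul.1 hx'
  obtain ⟨q, hq, n, hn, rfl⟩ := Set.mem_mul.1 (hA ha)
  have hmem : n * n' ∈ Q' ⊓ N' := by
    refine Subgroup.mem_inf.2 ⟨?_, N'.mul_mem (hNN' hn) hn'⟩
    have : n * n' = q⁻¹ * (q * n * n') := by rw [mul_assoc, inv_mul_cancel_left]
    rw [this]
    exact Q'.mul_mem (Q'.inv_mem (hQQ' hq)) hxQ'
  rw [hdisj, Subgroup.mem_bot] at hmem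
  rw [mul_assoc, hmem, mul_one]
  exact hq

/-- **Dévissage of an index along a normal subgroup with a complement**: let `A ≤ A'` with `A' = Q'·N'`, `A'`
normalising `N'`, `Q', N' ≤ A'`, `Q' ∩ N' = 1`, and `A = Q·N` with `Q ≤ A`, `Q ≤ Q'`, `A ∩ N' = N`.  Then
`[A' : A] = [Q' : Q]·[N' : N]` (`[A' : AN'] = [Q' : Q]` in `A'/N' ≃ Q'`, `[AN' : A] = [N' : N]`).  This is how the
modulus of a Borel subgroup is computed root group by root group. [cite: Laumon1995, (4.1.3)–(4.1.4)]
[cite: CartierCorvallis1979, §I.3] -/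
theorem relIndex_eq_mul_relIndex_of_devissage {A A' N N' Q Q' : Subgroup G} (hAA' : A ≤ A') (hN'A' : N' ≤ A')
    (hQ'A' : Q' ≤ A') (hA' : (A' : Set G) ⊆ (Q' : Set G) * (N' : Set G)) (hA'n : A' ≤ Subgroup.normalizer (N' : Set G))
    (hA : (A : Set G) ⊆ (Q : Set G) * (N : Set G)) (hQA : Q ≤ A) (hN : A ⊓ N' = N) (hQQ' : Q ≤ Q')
    (hdisj : Q' ⊓ N' = ⊥) : A.relIndex A' = Q.relIndex Q' * N.relIndex N' := by
  have hAn : A ≤ Subgroup.normalizer (N' : Set G) := hAA'.trans hA'n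
  have hNN' : N ≤ N' := hN ▸ inf_le_right
  have hAH : A ≤ A ⊔ N' := le_sup_left
  have hHA' : A ⊔ N' ≤ A' := sup_le hAA' hN'A'
  -- `[AN' : A] = [N' : N]`
  have h₁ : A.relIndex (A ⊔ N') = N.relIndex N' := by
    have hsub : ((A ⊔ N' : Subgroup G) : Set G) ⊆ (N' : Set G) * (A : Set G) := by
      rw [Subgroup.coe_mul_of_left_le_normalizer_right A N' hAn]
      exact subset_mul_of_le_normalizer hAn
    rw [relIndex_eq_relIndex_of_coe_subset_mul le_sup_right hsub, ← Subgroup.inf_relIndex_right, hN]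
  -- `[A' : AN'] = [Q' : Q]`
  have h₂ : (A ⊔ N').relIndex A' = Q.relIndex Q' := by
    have hsub : (A' : Set G) ⊆ (Q' : Set G) * ((A ⊔ N' : Subgroup G) : Set G) :=
      hA'.trans (Set.mul_subset_mul_left (SetLike.coe_subset_coe.2 le_sup_right))
    rw [relIndex_eq_relIndex_of_coe_subset_mul hQ'A' hsub, ← Subgroup.inf_relIndex_right,
      sup_inf_eq_of_coe_subset_mul hA hQA hNN' hQQ' hAn hdisj]
  rw [← Subgroup.relIndex_mul_relIndex A (A ⊔ N') A' hAH hHA', h₁, h₂, mul_comm]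

end Devissage

/-! ## §3 The index of the valuation ideals: `[{v ≤ exp a} : {v ≤ exp b}] = q^{a-b}` -/

section ValuedCount

open Literature.NumberTheory.Automorphic.CartanUnique

variable {K : Type*} [Field K] [Valued K ℤᵐ⁰] {ϖ : K}

/-- The closed unit ball is the valuation ring: `{v ≤ 1} = 𝒪` (as additive subgroups of `K`).
[cite: Serre1979, Ch. I §1] -/
theorem leAddSubgroup_one_eq_toAddSubgroup_integer :
    (Valued.v : Valuation K ℤᵐ⁰).leAddSubgroup (1 : ℤᵐ⁰) = (𝒪[K]).toAddSubgroup := by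
  ext x
  exact Iff.rfl

/-- **Scaling the balls**: `c · {v ≤ γ} = {v ≤ v(c)·γ}` for `c ≠ 0`. [cite: Serre1979, Ch. I §1] -/
theorem map_mulLeft_leAddSubgroup {c : K} (hc : c ≠ 0) (γ : ℤᵐ⁰) :
    ((Valued.v : Valuation K ℤᵐ⁰).leAddSubgroup γ).map (AddMonoidHom.mulLeft c) = (Valued.v : Valuation K ℤᵐ⁰).leAddSubgroup (Valued.v c * γ) := by
  have hvc : Valued.v c ≠ 0 := (Valuation.ne_zero_iff _).2 hc
  ext y
  simp only [AddSubgroup.mem_map, Valuation.mem_leAddSubgroup_iff, AddMonoidHom.coe_mulLeft]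
  constructor
  · rintro ⟨x, hx, rfl⟩
    rw [map_mul]
    exact mul_le_mul_right hx _
  · intro hy
    refine ⟨c⁻¹ * y, ?_, by rw [mul_inv_cancel_left₀ hc]⟩
    rw [map_mul, map_inv₀]
    calc (Valued.v c)⁻¹ * Valued.v y ≤ (Valued.v c)⁻¹ * (Valued.v c * γ) := mul_le_mul_right hy _
      _ = γ := by rw [inv_mul_cancel_left₀ hvc]

/-- **`{v ≤ exp(-k)} ∩ 𝒪 = (ϖ^k)`**: the preimage of the ball of radius `exp(-k)` in `𝒪` is the principal ideal
generated by `ϖ^k` (every `x` with `v x ≤ v ϖ^k` is `(x/ϖ^k)·ϖ^k` with `x/ϖ^k ∈ 𝒪`). [cite: Serre1979, Ch. I §1, Prop. 1] -/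
theorem comap_subtype_leAddSubgroup_exp_neg (hϖ : Valued.v ϖ = WithZero.exp (-1 : ℤ)) (k : ℕ) :
    ((Valued.v : Valuation K ℤᵐ⁰).leAddSubgroup (WithZero.exp (-(k : ℤ)))).comap (𝒪[K].subtype : 𝒪[K] →+* K).toAddMonoidHom =
      (Ideal.span {(⟨ϖ, uniformizer_mem_integer hϖ⟩ : 𝒪[K]) ^ k}).toAddSubgroup := by
  have hϖ0 := uniformizer_ne_zero hϖ
  ext x
  rw [AddSubgroup.mem_comap, Valuation.mem_leAddSubgroup_iff]
  change Valued.v (x : K) ≤ _ ↔ x ∈ Ideal.span {(⟨ϖ, uniformizer_mem_integer hϖ⟩ : 𝒪[K]) ^ k}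
  rw [Ideal.mem_span_singleton']
  constructor
  · intro hx
    have hmem : (x : K) / ϖ ^ k ∈ 𝒪[K] := by
      rw [Valuation.mem_integer_iff, map_div₀, v_uniformizer_pow hϖ]
      exact div_le_one_of_le₀ hx zero_le
    refine ⟨⟨(x : K) / ϖ ^ k, hmem⟩, Subtype.ext ?_⟩
    rw [Subring.coe_mul, SubmonoidClass.coe_pow]
    exact div_mul_cancel₀ (x : K) (pow_ne_zero k hϖ0)
  · rintro ⟨a, rfl⟩
    rw [Subring.coe_mul, SubmonoidClass.coe_pow, map_mul, v_uniformizer_pow hϖ]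
    exact mul_le_of_le_one_left zero_le a.2

/-- The range of `𝒪 ↪ K` as an additive map is `𝒪`. [folklore] -/
private theorem range_toAddMonoidHom_subtype_integer :
    ((𝒪[K].subtype : 𝒪[K] →+* K).toAddMonoidHom).range = (𝒪[K]).toAddSubgroup := by
  ext y
  constructor
  · rintro ⟨x, rfl⟩
    exact x.2
  · intro hy
    exact ⟨⟨y, hy⟩, rfl⟩

/-- **`#(𝒪/(ϖ^k)) = q^k`** (`𝒪` a DVR with `𝔪 = (ϖ)`, `#(𝒪/𝔪^k) = #(𝒪/𝔪)^k` from `𝔪^i/𝔪^{i+1} ≃ 𝓀`).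
[cite: Serre1979, Ch. II §3, Prop. 5 and Ch. I §1, Prop. 1] -/
theorem cardQuot_span_uniformizer_pow (hϖ : Valued.v ϖ = WithZero.exp (-1 : ℤ)) [Finite 𝓀[K]] (k : ℕ) :
    Submodule.cardQuot (Ideal.span {(⟨ϖ, uniformizer_mem_integer hϖ⟩ : 𝒪[K]) ^ k}) = Nat.card 𝓀[K] ^ k := by
  haveI := isDiscreteValuationRing_integer hϖ
  rw [← Ideal.span_singleton_pow, ← (irreducible_uniformizer hϖ).maximalIdeal_eq,
    cardQuot_pow_of_prime (IsDiscreteValuationRing.not_a_field 𝒪[K])]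
  rfl

/-- **`[𝒪 : ϖ^k 𝒪] = q^k`**: the ball `{v ≤ exp(-k)} = ϖ^k𝒪` has index `q^k` in `{v ≤ 1} = 𝒪`, `q = #𝓀`.
[cite: Serre1979, Ch. II §3, Prop. 5] [cite: Macdonald1995, Ch. II §1] -/
theorem relIndex_leAddSubgroup_exp_neg_natCast (hϖ : Valued.v ϖ = WithZero.exp (-1 : ℤ)) [Finite 𝓀[K]] (k : ℕ) :
    ((Valued.v : Valuation K ℤᵐ⁰).leAddSubgroup (WithZero.exp (-(k : ℤ)))).relIndex ((Valued.v : Valuation K ℤᵐ⁰).leAddSubgroup (1 : ℤᵐ⁰)) =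
      Nat.card 𝓀[K] ^ k := by
  rw [leAddSubgroup_one_eq_toAddSubgroup_integer, ← range_toAddMonoidHom_subtype_integer, ← AddSubgroup.index_comap,
    comap_subtype_leAddSubgroup_exp_neg hϖ, ← cardQuot_span_uniformizer_pow hϖ k]
  rfl

/-- **`[{v ≤ exp a} : {v ≤ exp b}] = q^{(a - b)⁺}`** for all `a, b ∈ ℤ`: `q^{a-b}` for `b ≤ a` (scale `[𝒪 : ϖ^{a-b}𝒪]` by
`ϖ^{-a}`), and `1` for `a ≤ b` (then `{v ≤ exp a} ⊆ {v ≤ exp b}`). [cite: Serre1979, Ch. II §3, Prop. 5]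
[cite: CartierCorvallis1979, §I.3] -/
theorem relIndex_leAddSubgroup_exp (hϖ : Valued.v ϖ = WithZero.exp (-1 : ℤ)) [Finite 𝓀[K]] (a b : ℤ) :
    ((Valued.v : Valuation K ℤᵐ⁰).leAddSubgroup (WithZero.exp b)).relIndex ((Valued.v : Valuation K ℤᵐ⁰).leAddSubgroup (WithZero.exp a)) =
      Nat.card 𝓀[K] ^ (a - b).toNat := by
  rcases le_or_gt b a with hba | hab
  · -- `b = a - k`
    obtain ⟨k, hk⟩ := Int.eq_ofNat_of_zero_le (sub_nonneg.2 hba)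
    have hϖ0 := uniformizer_ne_zero hϖ
    have hc : ϖ ^ (-a) ≠ 0 := zpow_ne_zero _ hϖ0
    have hinj : Function.Injective (AddMonoidHom.mulLeft (ϖ ^ (-a))) := mul_right_injective₀ hc
    have h1 : ((Valued.v : Valuation K ℤᵐ⁰).leAddSubgroup (1 : ℤᵐ⁰)).map (AddMonoidHom.mulLeft (ϖ ^ (-a))) =
        (Valued.v : Valuation K ℤᵐ⁰).leAddSubgroup (WithZero.exp a) := by
      rw [map_mulLeft_leAddSubgroup hc, v_uniformizer_zpow hϖ, neg_neg, mul_one]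
    have h2 : ((Valued.v : Valuation K ℤᵐ⁰).leAddSubgroup (WithZero.exp (-(k : ℤ)))).map (AddMonoidHom.mulLeft (ϖ ^ (-a))) =
        (Valued.v : Valuation K ℤᵐ⁰).leAddSubgroup (WithZero.exp b) := by
      rw [map_mulLeft_leAddSubgroup hc, v_uniformizer_zpow hϖ, neg_neg, ← WithZero.exp_add]
      congr 2
      omega
    rw [hk, Int.toNat_natCast, ← h1, ← h2, AddSubgroup.relIndex_map_map_of_injective _ _ hinj,
      relIndex_leAddSubgroup_exp_neg_natCast hϖ k]
  · rw [Int.toNat_of_nonpos (sub_nonpos.2 hab.le), pow_zero]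
    exact AddSubgroup.relIndex_eq_one.2 (Valuation.leAddSubgroup_monotone _ (WithZero.exp_le_exp.2 hab.le))

/-- Multiplicative copy (for transport along one-parameter subgroups `Multiplicative K →* G`):
`[{v ≤ exp a} : {v ≤ exp b}] = q^{(a-b)⁺}` for the corresponding subgroups of `Multiplicative K`.
[cite: Serre1979, Ch. II §3, Prop. 5] -/
theorem relIndex_toSubgroup_leAddSubgroup_exp (hϖ : Valued.v ϖ = WithZero.exp (-1 : ℤ)) [Finite 𝓀[K]] (a b : ℤ) :
    (AddSubgroup.toSubgroup ((Valued.v : Valuation K ℤᵐ⁰).leAddSubgroup (WithZero.exp b))).relIndex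
        (AddSubgroup.toSubgroup ((Valued.v : Valuation K ℤᵐ⁰).leAddSubgroup (WithZero.exp a))) = Nat.card 𝓀[K] ^ (a - b).toNat := by
  rw [AddSubgroup.relIndex_toSubgroup, relIndex_leAddSubgroup_exp hϖ]

/-- The indices `[{v ≤ exp a} : {v ≤ exp b}]` are non-zero (the balls are commensurable).
[cite: CartierCorvallis1979, §I.3] -/
theorem relIndex_leAddSubgroup_exp_ne_zero (hϖ : Valued.v ϖ = WithZero.exp (-1 : ℤ)) [Finite 𝓀[K]] (a b : ℤ) :
    ((Valued.v : Valuation K ℤᵐ⁰).leAddSubgroup (WithZero.exp b)).relIndex ((Valued.v : Valuation K ℤᵐ⁰).leAddSubgroup (WithZero.exp a)) ≠ 0 := by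
  rw [relIndex_leAddSubgroup_exp hϖ]
  exact pow_ne_zero _ (Nat.card_pos (α := 𝓀[K])).ne'

end ValuedCount

end Literature.NumberTheory.Automorphic
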